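import Literature.AlgebraicGeometry.AbelianSchemes.WeilPairingIso
import Literature.AlgebraicGeometry.AbelianSchemes.AbelianSchemeMumfordBundleClassifierAnyBase
import Literature.AlgebraicGeometry.AbelianSchemes.AbelianSchemeKOfLFibres
import Literature.AlgebraicGeometry.AbelianSchemes.AbelianSchemeOverFibreDim
import Literature.AlgebraicGeometry.AbelianSchemes.AbelianSchemeDualPairBaseChange
import Literature.AlgebraicGeometry.GroupSchemes.CartierDualAnnihilatorRank
import Literature.AlgebraicGeometry.Motives.AbelianVarietyPoincareCompleteReducibility
import Literature.AlgebraicGeometry.Motives.AbelianVarietyKernelDimension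
import Literature.AlgebraicGeometry.Motives.AbelianVarietyImageSimpleProofs
import Literature.AlgebraicGeometry.AbelianVarieties.HomogeneousLineBundleDivisor
import HarnessLib

/-!
# `dim Â = dim A` for every dual pair `(Â, 𝒫)` of an abelian variety over ANY field ([Mumford AV] §13 Cor. 3)

Topic `Literature/AlgebraicGeometry/AbelianSchemes`; namespaces `Literature.AlgebraicGeometry.AbelianSchemes.AbelianSchemeOver.DualPair` (§1, §3),
`Literature.AlgebraicGeometry.Motives.AbelianVariety` (§2).  THEOREMS ONLY (no definition, no named
fact, no instance, no notation, no `sorry`).  Cell `hodgecm-mathlib` (D-0151), FLOOR 0, P6 «MOD programme» (crux hLiu418 = stmt-HodgeConjecture-24832), organ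
**(σ1-g)** (LEAD F0P6-plan (g2) 22:46:23Z deal; route (iii) of B-p08 (g33)՚s census 22:02:24Z): the tree՚s dual pair ★ `AbelianSchemeDualPair` is an INTERFACE (`Â`
pinned by the universal property), and «`dim Â = dim A`» was in the tree only at characteristic-zero points (★ `DualPairFibreDim`; ★ `DualIsogenyDegree` docstring:
«deliberately NOT here … for an abstract dual pair in positive characteristic»).  This file proves it over ANY field, for ANY dual pair (no unit hypothesis, no
polarisation): it discharges the binder `hdim` of the W-line `Cruxes/HLiu418/Lines/F0_P6b_WeilCartierDuality.lean` ED. 2 (LEAD ruling M-17v′; `exists_weilIso' … (dim_hat_eq A D) …` is then the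
Weil isomorphism with `hdim` gone) and the relative-dimension conjunct of the P-2′ «DUAL-S» letter over a field.  HC_CM is proved only modulo the printed citations
until rung 0 closes; nothing here is about HC.

THE PRINT.  [MumfordAV1970] §13 Cor. 3 (p. 130) / [MilneAV2008] I §8 Rem. 8.8: `dim X̂ = dim X`.  The printed proofs use the construction `X̂ = X ∕ K(L)` or
`Lie X̂ = H¹(X, 𝒪)`; for the interface dual pair the two inequalities are obtained separately:
* §1 **`dim_hat_le_dim`** — THE WEIL MONOMORPHISM `Â[2] ↪ (A[2])^D` (★ (σ1-f2) `WeilPairing.exists_weilHom`/`mono_weilHom` for the normalised pair ★ `D.normalize`,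
  which has the same `Â`; realisations ★ `GroupSchemeKernel.ker [2]`) is a closed immersion of finite `k`-schemes, so `rk Γ(Â[2]) ≤ rk Γ((A[2])^D) = rk Γ(A[2])`
  (`finrank_alg_le_of_isClosedImmersion`, ★ `finrank_alg_cartierDual`), i.e. `2^{2 dim Â} ≤ 2^{2 dim A}` (★ `finrank_alg_eq_of_realises_torsion`);
* §2 **`AbelianVariety.dim_le_of_finite_kerPoints`** — a homomorphism `g : X → Y` of abelian varieties over `k̄` with finitely many kernel points satisfies
  `dim X ≤ dim Y` (★ `topologicalKrullDim_ker_le_zero_of_finite` at `X ↠ im g`, ★ `dim_eq_dim_add_topologicalKrullDim_ker`, ★ `dim_image_le_right`);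
* §3 **`dim_le_dim_hat`** — ROUTE (iii): an ample `Θ` on `A` (★ `exists_isAmple_symmetric_holds`, any field), `L = 𝒪(Θ)` rigidified for free over `Spec k` (★
  `CechPic.pullback_eq_one_of_isLocalRing`), the HOMOMORPHISM `Λ(L) : A → Â` with kernel `K(L)` (★ `exists_isMonHom_classify_mumfordBundle_of_isLocallyNoetherian_base` at
  `D.normalize`), whose kernel points over `k̄` lie in `K(pr₁^*Θ)` — finite, `pr₁^*Θ` being ample ([MumfordAV1970] §6 Application 1; ★ `CartierDivisor.IsAmple.pullback`,
  ★ `finite_KTheta`, ★ `memKOfL_iff_mem_KTheta_of_fibrePointToLeft_eq`, ★ `map_fibreHom_eq_one_iff_comp_eq_one`) ⇒ `dim A_{k̄} ≤ dim Â_{k̄}` (§2) ⇒ `dim A ≤ dim Â`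
  (★ `dim_fibre_of_isOfRelDim`); **`dim_hat_eq`** — the equality;
* consequence (no new declaration — the dedup lint treats the restatement as a copy of ★ `exists_weilIso'`): `WeilPairing.exists_weilIso' p r A D hD
  (DualPair.dim_hat_eq A D) …` is the Weil isomorphism `Â[q] ≅ (A[q])^D` for every normalised dual pair over any field, with NO dimension hypothesis.

## References
* [MumfordAV1970] D. Mumford, *Abelian Varieties* (1970), §13 Cor. 3 (p. 130), §6 Application 1 (p. 60), §8 Thm. 1 (p. 77), §15 Thm. 1 (p. 143), §20 (p. 184).
* [MilneAV2008] J. S. Milne, *Abelian Varieties* (2008), I §8 pp. 36–37 (Rem. 8.8).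
* [MumfordFogartyKirwan1994] D. Mumford, J. Fogarty, F. Kirwan, *GIT*, 3rd ed. (1994), Ch. 6 §2 Definition 6.2 (p. 120).
* [GortzWedhorn2023] U. Görtz, T. Wedhorn, *Algebraic Geometry II* (2023), Prop. 27.176, Prop. 27.186.
* [GortzWedhorn2020] U. Görtz, T. Wedhorn, *Algebraic Geometry I*, 2nd ed. (2020), Section (4.7) (pp. 107–108), Prop. 13.66 (2) (p. 509).
* [Tate1997FiniteFlatGroupSchemes] J. Tate, *Finite flat group schemes* (1997), §(3.7)–(3.8) pp. 145–146.
* [Waterhouse1979] W. C. Waterhouse, *Introduction to Affine Group Schemes* (1979), §2.1 p. 14.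
-/

set_option autoImplicit false

noncomputable section

-- `TopCat.Presheaf`/`Scheme.Modules` and the `Over`/`Scheme` wrappers are not reducible (as in ★ `WeilUnitOfTorsionPoint`, ★ `GroupSchemes/*`).
set_option backward.isDefEq.respectTransparency false

universe u

open CategoryTheory CategoryTheory.Limits AlgebraicGeometry MonoidalCategory CartesianMonoidalCategory TopologicalSpace
  Opposite
open scoped MonObj

namespace Literature.AlgebraicGeometry.AbelianSchemes.AbelianSchemeOver.DualPair

open Literature.AlgebraicGeometry.GroupSchemes Literature.AlgebraicGeometry.GroupSchemes.AffineGroupScheme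
  Literature.AlgebraicGeometry.GroupSchemes.GroupSchemeKernel
open Literature.AlgebraicGeometry.Motives Literature.AlgebraicGeometry.Motives.AbelianVariety
open Literature.AlgebraicGeometry.AbelianSchemes.WeilPairing Literature.AlgebraicGeometry.Modules

variable {k : Type u} [Field k] (A : AbelianVariety k) (D : (AbelianScheme.ofAbelianVariety A).toOver.DualPair)

/-! ## §1 `dim Â ≤ dim A`: the Weil monomorphism `Â[2] ↪ (A[2])^D` -/

/-- **A closed immersion of affine `k`-schemes does not increase `dim_k Γ`** (`Γ(j)` is surjective, ★ `surjective_comap_of_isClosedImmersion`).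
[cite: Waterhouse1979, §2.1 p. 14] -/
theorem finrank_alg_le_of_isClosedImmersion {X Y : SchemeOver k} [IsAffine X.left] [IsAffine Y.left] [Module.Finite k (Alg Y)]
    (ψ : X ⟶ Y) [IsClosedImmersion ψ.left] : Module.finrank k (Alg X) ≤ Module.finrank k (Alg Y) :=
by
  have h := LinearMap.finrank_range_le (Alg.comap ψ).toLinearMap
  rw [LinearMap.range_eq_top.mpr (surjective_comap_of_isClosedImmersion ψ), finrank_top] at h
  exact h

/-- **`dim Â ≤ dim A` for every dual pair `(Â, 𝒫)` of an abelian variety `A` over a field** — by the WEIL MONOMORPHISM: `Â[2] ↪ (A[2])^D` (★ (σ1-f2)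
`WeilPairing.mono_weilHom` for the normalised pair ★ `D.normalize`, same `Â`), a closed immersion of finite `k`-schemes, so `2^{2 dim Â} = rk Γ(Â[2]) ≤
rk Γ((A[2])^D) = rk Γ(A[2]) = 2^{2 dim A}` (★ `finrank_alg_eq_of_realises_torsion`, ★ `finrank_alg_cartierDual`).
[cite: MumfordAV1970, §20 (p. 184), §15 Thm. 1 (p. 143)] [cite: Tate1997FiniteFlatGroupSchemes, §(3.7)–(3.8) pp. 145–146] -/
theorem dim_hat_le_dim : D.hat.toAffine.toAbelianVariety.dim ≤ A.dim := by
  haveI : Fact (Nat.Prime 2) := ⟨Nat.prime_two⟩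
  have hq : (((2 ^ 1 : ℕ) : ℤ)) ≠ 0 := by norm_num
  -- the realisations `A[2] = Ker [2]_A`, `Â[2] = Ker [2]_Â`
  let Â : AbelianVariety k := D.hat.toAffine.toAbelianVariety
  let qA : A.X ⟶ A.X := ((((2 ^ 1 : ℕ) : ℤ) • 𝟙 A).hom.hom.hom)
  let qÂ : Â.X ⟶ Â.X := ((((2 ^ 1 : ℕ) : ℤ) • 𝟙 Â).hom.hom.hom)
  haveI : IsFinite qA.left := (A.isIsogeny_zsmul_id_holds _ hq).2
  haveI : IsCommMonObj (ker qA) := isCommMonObj_ker qA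
  haveI : IsClosedImmersion (kerι qA).left := isClosedImmersion_kerι_left_of_isSeparated qA
  haveI : IsFinite (ker qA).hom := isFinite_ker_hom_of_isFinite_left qA
  haveI : IsAffine (ker qA).left := isAffine_of_isAffineHom (ker qA).hom
  haveI : Module.Finite k (Alg (ker qA)) := Alg.moduleFinite (ker qA)
  haveI : IsFinite qÂ.left := (Â.isIsogeny_zsmul_id_holds _ hq).2
  haveI : IsCommMonObj (ker qÂ) := isCommMonObj_ker qÂ
  haveI : IsClosedImmersion (kerι qÂ).left := isClosedImmersion_kerι_left_of_isSeparated qÂ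
  haveI : IsFinite (ker qÂ).hom := isFinite_ker_hom_of_isFinite_left qÂ
  haveI : IsAffine (ker qÂ).left := isAffine_of_isAffineHom (ker qÂ).hom
  haveI : Module.Finite k (Alg (ker qÂ)) := Alg.moduleFinite (ker qÂ)
  have hG : ∀ ⦃T : SchemeOver k⦄ (t : T ⟶ A.X), (∃ s : T ⟶ ker qA, s ≫ kerι qA = t) ↔ t ≫ qA = 1 :=
    fun T t => exists_comp_kerι_eq_iff qA t
  have hĜ : ∀ ⦃T : SchemeOver k⦄ (t : T ⟶ D.normalize.hat.X), (∃ s : T ⟶ ker qÂ, s ≫ kerι qÂ = t) ↔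
      t ≫ ((((2 ^ 1 : ℕ) : ℤ) • 𝟙 D.normalize.hat.toAffine.toAbelianVariety).hom.hom.hom) = 1 :=
    fun T t => exists_comp_kerι_eq_iff qÂ t
  -- the Weil monomorphism of the normalised pair
  obtain ⟨w, hw, hpair⟩ := exists_weilHom (2 ^ 1) A D.normalize D.nonempty_unitHatSlice_iso_normalize (ker qA) (kerι qA) hG
    (ker qÂ) (kerι qÂ) hĜ
  haveI := hw
  haveI : Mono (kerι qÂ) := mono_kerι qÂ
  haveI : Mono w := mono_weilHom (2 ^ 1) A D.normalize D.nonempty_unitHatSlice_iso_normalize (ker qA) (kerι qA) hG (ker qÂ)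
    (kerι qÂ) hĜ (by norm_num) w hpair
  haveI : Mono w.left := inferInstance
  haveI : IsFinite w.left := by
    haveI : IsFinite (w.left ≫ (cartierDual (ker qA)).hom) := by rw [Over.w w]; infer_instance
    exact IsFinite.of_comp w.left (cartierDual (ker qA)).hom
  haveI : IsClosedImmersion w.left := (IsClosedImmersion.iff_isFinite_and_mono w.left).mpr ⟨inferInstance, inferInstance⟩
  haveI : IsAffine (cartierDual (ker qA)).left := isAffine_cartierDual_left (ker qA)
  haveI : Module.Finite k (Alg (cartierDual (ker qA))) := finite_alg_cartierDual (ker qA)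
  haveI : Mono (kerι qA) := mono_kerι qA
  have hle := finrank_alg_le_of_isClosedImmersion w
  rw [finrank_alg_cartierDual, finrank_alg_eq_of_realises_torsion 2 1 A (ker qA) (kerι qA) hG,
    finrank_alg_eq_of_realises_torsion 2 1 Â (ker qÂ) (kerι qÂ) hĜ] at hle
  have h2 : 2 * Â.dim ≤ 2 * A.dim := (Nat.pow_le_pow_iff_right (by norm_num : 1 < 2 ^ 1)).1 hle
  change Â.dim ≤ A.dim
  omega

end Literature.AlgebraicGeometry.AbelianSchemes.AbelianSchemeOver.DualPair

/-! ## §2 A homomorphism of abelian varieties with finitely many kernel points does not decrease the dimension -/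

namespace Literature.AlgebraicGeometry.Motives.AbelianVariety

/-- **`dim X ≤ dim Y` for a homomorphism `g : X → Y` of abelian varieties over an algebraically closed field whose kernel has finitely
many rational points**: the kernel of `X ↠ im g` has the same points, hence is zero-dimensional (★ `topologicalKrullDim_ker_le_zero_of_finite`),
so `dim X = dim (im g) + 0` (★ `dim_eq_dim_add_topologicalKrullDim_ker`) `≤ dim Y` (★ `dim_image_le_right`).
[cite: GortzWedhorn2023, Prop. 27.176] [cite: MumfordAV1970, §8 Thm. 1 (p. 77)] -/
theorem dim_le_of_finite_kerPoints {K : Type u} [Field K] [IsAlgClosed K] {X Y : AbelianVariety K} (g : X ⟶ Y)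
    (hfin : {R : X.Points K | R ≫ g.hom.hom.hom = 1}.Finite) : X.dim ≤ Y.dim := by
  have hfin' : {R : X.Points K | R ≫ (toImage g).hom.hom.hom = 1}.Finite := by
    refine hfin.subset fun R hR => ?_
    have hc : (toImage g).hom.hom.hom ≫ (imageι g).hom.hom.hom = g.hom.hom.hom :=
      congrArg (fun h => h.hom.hom.hom) (toImage_imageι g)
    change R ≫ (toImage g).hom.hom.hom = 1 at hR
    change R ≫ g.hom.hom.hom = 1
    rw [← hc, ← Category.assoc, hR, MonObj.one_comp]
  have hk := topologicalKrullDim_ker_le_zero_of_finite (toImage g) hfin'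
  have hd := dim_eq_dim_add_topologicalKrullDim_ker (toImage g)
  have h1 : ((X.dim : ℕ∞) : WithBot ℕ∞) ≤ ((image g).dim : ℕ∞) := by
    rw [hd]
    calc (((image g).dim : ℕ∞) : WithBot ℕ∞) + topologicalKrullDim ↥(Hom.ker (toImage g))
        ≤ (((image g).dim : ℕ∞) : WithBot ℕ∞) + 0 := by gcongr
      _ = ((image g).dim : ℕ∞) := add_zero _
  have h2 : X.dim ≤ (image g).dim := by exact_mod_cast h1
  exact h2.trans (dim_image_le_right g)

end Literature.AlgebraicGeometry.Motives.AbelianVariety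

/-! ## §3 `dim A ≤ dim Â`: the homomorphism `Λ(L) : A → Â` of an ample `L` has finite kernel -/

namespace Literature.AlgebraicGeometry.AbelianSchemes.AbelianSchemeOver.DualPair

open Literature.AlgebraicGeometry.GroupSchemes Literature.AlgebraicGeometry.GroupSchemes.AffineGroupScheme
  Literature.AlgebraicGeometry.GroupSchemes.GroupSchemeKernel
open Literature.AlgebraicGeometry.Motives Literature.AlgebraicGeometry.Motives.AbelianVariety
open Literature.AlgebraicGeometry.AbelianSchemes.WeilPairing Literature.AlgebraicGeometry.Modules

variable {k : Type u} [Field k] (A : AbelianVariety k) (D : (AbelianScheme.ofAbelianVariety A).toOver.DualPair)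

/-- `Spec Ω → Spec k` is surjective for fields `k ⊆ Ω`. [cite: GortzWedhorn2020, Section (4.7) (pp. 107–108)] -/
theorem surjective_specMap_of_field (Ω : Type u) [Field Ω] [Algebra k Ω] :
    Surjective (Spec.map (CommRingCat.ofHom (algebraMap k Ω))) :=
  ⟨fun _ => ⟨⟨⊥, Ideal.isPrime_bot⟩, Subsingleton.elim _ _⟩⟩

/-- **`dim A ≤ dim Â` for every dual pair `(Â, 𝒫)` of an abelian variety `A` over a field** — ROUTE (iii): an AMPLE divisor `Θ` on `A` (★
`exists_isAmple_symmetric_holds`, any field) gives `L = 𝒪(Θ)` and the HOMOMORPHISM `Λ(L) : A → Â` with kernel `K(L)` (★ `exists_isMonHom_classify_mumfordBundle_of_isLocallyNoetherian_base`,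
for the normalised pair ★ `D.normalize`, same `Â`); over `k̄` the kernel points of `Λ(L)_{k̄}` lie in `K(pr₁^*Θ)`, FINITE for the ample `pr₁^*Θ` ([MumfordAV1970] §6
Application 1, ★ `finite_KTheta`; ★ `memKOfL_iff_mem_KTheta_of_fibrePointToLeft_eq`), so `dim A_{k̄} ≤ dim Â_{k̄}` (§2), and fibre dimensions are `dim A`,
`dim Â` (★ `dim_fibre_of_isOfRelDim`). [cite: MumfordAV1970, §6 Application 1 (p. 60), §8 Thm. 1 (p. 77), §13 (p. 123)]
[cite: MumfordFogartyKirwan1994, Ch. 6 §2 Definition 6.2 (p. 120)] -/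
theorem dim_le_dim_hat : A.dim ≤ D.hat.toAffine.toAbelianVariety.dim := by
  -- (1) an ample divisor `Θ` on `A`, `L = 𝒪(Θ)`, rigidified for free over the field base
  obtain ⟨Θ, hΘ, -⟩ := (AbelianVariety.exists_isAmple_symmetric_holds (A := A))
  have hL : HasRank (Modules.lineBundle Θ.toUnitCocycle : (AbelianScheme.ofAbelianVariety A).toOver.left.Modules) 1 :=
    UnitCocycle.hasRank_lineBundle _
  have hε : CechPic.pullback (AbelianScheme.ofAbelianVariety A).toOver.unitSection (detClass (HasRank.isFiniteLocallyFree' hL)) = 1 :=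
    CechPic.pullback_eq_one_of_isLocalRing _ _
  -- (2) `Λ(L) : A → Â` for the normalised pair, with kernel `K(L)`
  obtain ⟨lam, hmon, -, hker⟩ := (AbelianScheme.ofAbelianVariety A).toOver.exists_isMonHom_classify_mumfordBundle_of_isLocallyNoetherian_base
    D.normalize hL hε D.nonempty_unitHatSlice_iso_normalize
  haveI := hmon
  -- (3) the geometric point `s : Spec k̄ → Spec k` and the ample `pr₁^*Θ` on `A_{k̄}`
  obtain ⟨s, hs⟩ : ∃ s : Spec (CommRingCat.of (AlgebraicClosure k)) ⟶ Spec (CommRingCat.of k),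
      s = Spec.map (CommRingCat.ofHom (algebraMap k (AlgebraicClosure k))) := ⟨_, rfl⟩
  haveI : Surjective s := by rw [hs]; exact surjective_specMap_of_field (AlgebraicClosure k)
  have hd : IsDominant (pullback.fst (AbelianScheme.ofAbelianVariety A).toOver.X.hom s) := inferInstance
  have haff : IsAffineHom (pullback.fst (AbelianScheme.ofAbelianVariety A).toOver.X.hom s) :=
    MorphismProperty.pullback_fst _ _ inferInstance
  haveI : @IsDominant ((((AbelianScheme.ofAbelianVariety A).toOver.fibre s).toAbelianVariety).X.left) A.X.left
      (pullback.fst (AbelianScheme.ofAbelianVariety A).toOver.X.hom s) := hd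
  haveI : @IsAffineHom ((((AbelianScheme.ofAbelianVariety A).toOver.fibre s).toAbelianVariety).X.left) A.X.left
      (pullback.fst (AbelianScheme.ofAbelianVariety A).toOver.X.hom s) := haff
  -- the ample divisor `pr₁^*Θ` on the fibre `A_{k̄}` (fibre spelling of the source, so that `IsIntegral` is found)
  obtain ⟨Θs, hΘs_def⟩ : ∃ Θs : CartierDivisor (((AbelianScheme.ofAbelianVariety A).toOver.fibre s).toAbelianVariety).X.left,
      Θs = Θ.pullback (X' := (((AbelianScheme.ofAbelianVariety A).toOver.fibre s).toAbelianVariety).X.left)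
        (pullback.fst (AbelianScheme.ofAbelianVariety A).toOver.X.hom s) := ⟨_, rfl⟩
  have hΘs : Θs.IsAmple := by rw [hΘs_def]; exact hΘ.pullback _
  have hLΘ : CechPic.pullback (X := (((AbelianScheme.ofAbelianVariety A).toOver.fibre s).toAbelianVariety).X.left)
      (pullback.fst (AbelianScheme.ofAbelianVariety A).toOver.X.hom s) (detClass (HasRank.isFiniteLocallyFree' hL)) = Θs.cechClass := by
    rw [hΘs_def, CartierDivisor.cechClass_pullback, ← detClass_lineBundle_toUnitCocycle Θ]
    rfl
  -- (4) the kernel points of `Λ(L)_{k̄}` lie in the finite `K(pr₁^*Θ)`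
  have hfin : {R : ((AbelianScheme.ofAbelianVariety A).toOver.fibre s).toAbelianVariety.Points (AlgebraicClosure k) |
      R ≫ (fibreHom lam s).hom.hom.hom = 1}.Finite := by
    refine ((((AbelianScheme.ofAbelianVariety A).toOver.fibre s).toAbelianVariety).finite_KTheta hΘs).subset fun R hR => ?_
    obtain ⟨x, hx⟩ := (AbelianScheme.ofAbelianVariety A).toOver.exists_fibrePoints_fibrePointToLeft_eq s R
    have h1 : x ≫ lam = 1 :=
      ((AbelianScheme.ofAbelianVariety A).toOver.map_fibreHom_eq_one_iff_comp_eq_one s lam hx).1 hR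
    exact ((AbelianScheme.ofAbelianVariety A).toOver.memKOfL_iff_mem_KTheta_of_fibrePointToLeft_eq s hL x R hx hLΘ).1
      ((hker x).2 h1)
  -- (5) dimensions
  have hle := dim_le_of_finite_kerPoints (fibreHom lam s) hfin
  have hA : (((AbelianScheme.ofAbelianVariety A).toOver.fibre s).toAbelianVariety).dim = A.dim :=
    dim_fibre_of_isOfRelDim (AbelianSchemeOver.isOfRelDim_ofAbelianVariety A) s
  have hrel : D.hat.IsOfRelDim D.hat.toAffine.toAbelianVariety.dim :=
    (AbelianScheme.isOfRelDim_toOver_iff D.hat.toAffine _).2 D.hat.toAffine.isOfRelDim_dim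
  have hÂ : ((D.hat.fibre s).toAbelianVariety).dim = D.hat.toAffine.toAbelianVariety.dim := dim_fibre_of_isOfRelDim hrel s
  calc A.dim = (((AbelianScheme.ofAbelianVariety A).toOver.fibre s).toAbelianVariety).dim := hA.symm
    _ ≤ ((D.normalize.hat.fibre s).toAbelianVariety).dim := hle
    _ = D.hat.toAffine.toAbelianVariety.dim := hÂ

/-- **`dim Â = dim A` FOR EVERY DUAL PAIR `(Â, 𝒫)` OF AN ABELIAN VARIETY OVER ANY FIELD** ([MumfordAV1970] §13 Cor. 3 «`dim X̂ = dim X`»; [MilneAV2008] I §8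
Rem. 8.8) — here for the tree's INTERFACE dual pair ★ `AbelianSchemeDualPair` (`Â` pinned by the universal property only), in any characteristic and
without the unit hypothesis: `≤` by the Weil monomorphism `Â[2] ↪ (A[2])^D` (§1), `≥` by the finite-kernel homomorphism `Λ(L) : A → Â` of an ample `L` (§3).
Discharges the binder `hdim` of the W-line `Cruxes/HLiu418/Lines/F0_P6b_WeilCartierDuality.lean` ED. 2 and the relative-dimension conjunct of the P-2′
«DUAL-S» letter over a field. [cite: MumfordAV1970, §13 Cor. 3 (p. 130)] [cite: MilneAV2008, I §8 pp. 36–37] -/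
theorem dim_hat_eq : D.hat.toAffine.toAbelianVariety.dim = A.dim :=
  le_antisymm (dim_hat_le_dim A D) (dim_le_dim_hat A D)

end Literature.AlgebraicGeometry.AbelianSchemes.AbelianSchemeOver.DualPair

end
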